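import Summits.CriticalPhenomena.PercolationContinuityZ3.Theorems.PercNearOneGluingAdditiveGluingFamilyUPointwise
import Summits.CriticalPhenomena.PercolationContinuityZ3.Theorems.PercNearOneGluingAdditiveGluingLincombIntegral
import Summits.CriticalPhenomena.PercolationContinuityZ3.Theorems.PercNearOneGluingAdditiveGluingCrossAnyOneTwo
import Summits.CriticalPhenomena.PercolationContinuityZ3.Theorems.PercNearOneGluingAdditiveGluingCrossAnyTwoOne
import Summits.CriticalPhenomena.PercolationContinuityZ3.Theorems.PercNearOneGluingAdditiveGluingCrossAllOneTwo
import Summits.CriticalPhenomena.PercolationContinuityZ3.Theorems.PercNearOneGluingAdditiveGluingExchangePlain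
import Summits.CriticalPhenomena.PercolationContinuityZ3.Theorems.PercNearOneGluingAdditiveGluingExchangeHas
import Summits.CriticalPhenomena.PercolationContinuityZ3.Theorems.PercNearOneGluingAdditiveGluingExchangeAvoid
import HarnessLib

/-!
# Master family U of the three-relay certificate — generic assembly (lead c7)

`familyU_slack`: for three distinct relays with `τ₃ ≤ τ₁`, `τ₃ ≤ τ₂`, ANY real weights on the ingredients of family U
(order row `η`; BHK cross atoms for `X = 1, 2, 3` in the "b joins some / all of the other two" forms and for `X = 12, 13, 23`;
Kozma–Nitzan Lemma-3 exchanges `t2, th, ta`; definition rows `z_X`) that satisfy the sign constraints, the product constraints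
`c·u_X ≤ c'·v_X` (so that each primed coefficient dominates `c·φ_X`), the definition constraints `z'·v_X = z·u_X`, and the 43
per-pattern inequalities of `familyU_pointwise`, certify `μ(o ↔ A ∖ o ↔ b) ≤ μ(a₃ ↮ b)`.  Every LP(φ) chart of the lead's
atlas drawn from family U (charts F2, F3, …) is an instance: the chart supplies closed-form weights and checks the 43 inequalities
on its region.  [cite: KozmaNitzan2024, Theorem 2 (§3.1, pp. 8–9), Lemma 3 (p. 7); VandenbergHaggstromKahn2005, Thm. 1.4 (p. 7)]
-/

namespace Summit.CriticalPhenomena.PercolationContinuityZ3.Theorems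

open MeasureTheory Set Literature.Probability.LatticeModels Literature.Probability.Percolation
open scoped Classical

/-- From a product-form BHK cross atom `v·A ≤ u·B` (with `0 ≤ A, B ≤ v`) and weights `0 ≤ c`, `c·u ≤ c'·v`:
the weighted gap `c·A ≤ c'·B` (the case `v = 0` forces `A = B = 0`). [folklore] -/
theorem familyU_cross_gap {v u A B c c' : ℝ} (hv : 0 ≤ v) (hA : 0 ≤ A) (hAv : A ≤ v) (hB : 0 ≤ B) (hBv : B ≤ v)
    (atom : v * A ≤ u * B) (hc : 0 ≤ c) (hcc : c * u ≤ c' * v) : c * A ≤ c' * B := by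
  rcases hv.eq_or_lt with h | h
  · have hA0 : A = 0 := le_antisymm (h ▸ hAv) hA
    have hB0 : B = 0 := le_antisymm (h ▸ hBv) hB
    simp [hA0, hB0]
  · have key : v * (c * A) ≤ v * (c' * B) := by
      calc v * (c * A) = c * (v * A) := by ring
        _ ≤ c * (u * B) := mul_le_mul_of_nonneg_left atom hc
        _ = (c * u) * B := by ring
        _ ≤ (c' * v) * B := mul_le_mul_of_nonneg_right hcc hB
        _ = v * (c' * B) := by ring
    exact le_of_mul_le_mul_left key h

/-- **Family U, generic assembly.**  Any weights on family U satisfying the sign, product (`c·u ≤ c'·v`), definition (`z'·v = z·u`)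
constraints and the per-pattern inequalities of `familyU_pointwise` certify the three-relay E-form
`μ((o↔a₁ ∪ o↔a₂ ∪ o↔a₃) ∖ o↔b) ≤ μ(a₃ ↮ b)` when `τ₃ ≤ τ₁`, `τ₃ ≤ τ₂`. [cite: KozmaNitzan2024, Theorem 2 (§3.1, pp. 8–9)] -/
theorem familyU_slack : ∀ (n : ℕ) (w : Sym2 (Fin n) → unitInterval) (o b a₁ a₂ a₃ : Fin n) (h12 : a₁ ≠ a₂) (h13 : a₁ ≠ a₃) (h23 : a₂ ≠ a₃) (hτ31 : (prodBernoulli w).real (openConn a₃ b) ≤ (prodBernoulli w).real (openConn a₁ b)) (hτ32 : (prodBernoulli w).real (openConn a₃ b) ≤ (prodBernoulli w).real (openConn a₂ b)) (η c1 c1' d1 d1' c2 c2' d2 d2' c3 c3' d3 d3' p12 p12' p13 p13' p23 p23' t2 th ta z1 z1' z23 z23' z2 z2' z13 z13' z3 z3' z12 z12' : ℝ) (h0_η : 0 ≤ η) (h0_c1 : 0 ≤ c1) (h0_d1 : 0 ≤ d1) (h0_c2 : 0 ≤ c2) (h0_d2 : 0 ≤ d2) (h0_c3 : 0 ≤ c3)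 (h0_d3 : 0 ≤ d3) (h0_p12 : 0 ≤ p12) (h0_p13 : 0 ≤ p13) (h0_p23 : 0 ≤ p23) (h0_t2 : 0 ≤ t2) (h0_th : 0 ≤ th) (h0_ta : 0 ≤ ta) (hx_c1 : c1 * (prodBernoulli w).real (((openConn a₁ a₂)ᶜ ∩ (openConn a₁ a₃)ᶜ) ∩ openConn a₁ o) ≤ c1' * (prodBernoulli w).real ((openConn a₁ a₂)ᶜ ∩ (openConn a₁ a₃)ᶜ)) (hx_d1 : d1 * (prodBernoulli w).real (((openConn a₁ a₂)ᶜ ∩ (openConn a₁ a₃)ᶜ) ∩ openConn a₁ o) ≤ d1' * (prodBernoulli w).real ((openConn a₁ a₂)ᶜ ∩ (openConn a₁ a₃)ᶜ)) (hx_c2 : c2 * (prodBernoulli w).real (((openConn a₂ a₁)ᶜ ∩ (openConn a₂ a₃)ᶜ) ∩ openConn a₂ o) ≤ c2' * (prodBernoulli w).real ((openConn a₂ a₁)ᶜ ∩ (openConn a₂ a₃)ᶜ)) (hx_d2 : d2 * (prodBernoulli w).real (((openConn a₂ a₁)ᶜ ∩ (openConn a₂ a₃)ᶜ) ∩ openConn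 a₂ o) ≤ d2' * (prodBernoulli w).real ((openConn a₂ a₁)ᶜ ∩ (openConn a₂ a₃)ᶜ)) (hx_c3 : c3 * (prodBernoulli w).real (((openConn a₃ a₁)ᶜ ∩ (openConn a₃ a₂)ᶜ) ∩ openConn a₃ o) ≤ c3' * (prodBernoulli w).real ((openConn a₃ a₁)ᶜ ∩ (openConn a₃ a₂)ᶜ)) (hx_d3 : d3 * (prodBernoulli w).real (((openConn a₃ a₁)ᶜ ∩ (openConn a₃ a₂)ᶜ) ∩ openConn a₃ o) ≤ d3' * (prodBernoulli w).real ((openConn a₃ a₁)ᶜ ∩ (openConn a₃ a₂)ᶜ)) (hx_p12 : p12 * (prodBernoulli w).real (((openConn a₃ a₁)ᶜ ∩ (openConn a₃ a₂)ᶜ) ∩ (openConn a₁ o ∪ openConn a₂ o)) ≤ p12' * (prodBernoulli w).real ((openConn a₃ a₁)ᶜ ∩ (openConn a₃ a₂)ᶜ)) (hx_p13 : p13 * (prodBernoulli w).real (((openConn a₂ a₁)ᶜ ∩ (openConn a₂ a₃)ᶜ) ∩ (openConn a₁ o ∪ openConn a₃ o)) ≤ p13' * (prodBernoulli w).real ((openConn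 a₂ a₁)ᶜ ∩ (openConn a₂ a₃)ᶜ)) (hx_p23 : p23 * (prodBernoulli w).real (((openConn a₁ a₂)ᶜ ∩ (openConn a₁ a₃)ᶜ) ∩ (openConn a₂ o ∪ openConn a₃ o)) ≤ p23' * (prodBernoulli w).real ((openConn a₁ a₂)ᶜ ∩ (openConn a₁ a₃)ᶜ)) (hz_z1 : z1' * (prodBernoulli w).real ((openConn a₁ a₂)ᶜ ∩ (openConn a₁ a₃)ᶜ) = z1 * (prodBernoulli w).real (((openConn a₁ a₂)ᶜ ∩ (openConn a₁ a₃)ᶜ) ∩ openConn a₁ o)) (hz_z23 : z23' * (prodBernoulli w).real ((openConn a₁ a₂)ᶜ ∩ (openConn a₁ a₃)ᶜ) = z23 * (prodBernoulli w).real (((openConn a₁ a₂)ᶜ ∩ (openConn a₁ a₃)ᶜ) ∩ (openConn a₂ o ∪ openConn a₃ o))) (hz_z2 : z2' * (prodBernoulli w).real ((openConn a₂ a₁)ᶜ ∩ (openConn a₂ a₃)ᶜ) = z2 * (prodBernoulli w).real (((openConn a₂ a₁)ᶜ ∩ (openConn a₂ a₃)ᶜ) ∩ openConn a₂ o)) (hz_z13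 : z13' * (prodBernoulli w).real ((openConn a₂ a₁)ᶜ ∩ (openConn a₂ a₃)ᶜ) = z13 * (prodBernoulli w).real (((openConn a₂ a₁)ᶜ ∩ (openConn a₂ a₃)ᶜ) ∩ (openConn a₁ o ∪ openConn a₃ o))) (hz_z3 : z3' * (prodBernoulli w).real ((openConn a₃ a₁)ᶜ ∩ (openConn a₃ a₂)ᶜ) = z3 * (prodBernoulli w).real (((openConn a₃ a₁)ᶜ ∩ (openConn a₃ a₂)ᶜ) ∩ openConn a₃ o)) (hz_z12 : z12' * (prodBernoulli w).real ((openConn a₃ a₁)ᶜ ∩ (openConn a₃ a₂)ᶜ) = z12 * (prodBernoulli w).real (((openConn a₃ a₁)ᶜ ∩ (openConn a₃ a₂)ᶜ) ∩ (openConn a₁ o ∪ openConn a₂ o))) (hR1 : 0 ≤ 1 - z1' - z12' - z13' - z2' - z23' - z3') (hR2 : 0 ≤ 1 - z1' - z23') (hR3 : 0 ≤ 1 - z12' - z3') (hR4 : 0 ≤ 1 - z13' - z2') (hR5 : 0 ≤ 1 - c2' - c3' - p23' - ta - z1' - z12' - z13' - z2' - z23' - z3' - η) (hR6 : 0 ≤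 1 - p23' - ta - z1' - z23' - η) (hR7 : 0 ≤ 1 - c3' - d3' - t2 - ta - z12' - z3' - η) (hR8 : 0 ≤ -c2' - d2' + t2 - z13' - z2') (hR9 : 0 ≤ 1 - c1' - c3' - p13' - t2 - z1' - z12' - z13' - z2' - z23' - z3') (hR10 : 0 ≤ 1 - p13' - t2 - z13' - z2') (hR11 : 0 ≤ -c1' - d1' + ta - z1' - z23' + η) (hR12 : 0 ≤ -c1' - c2' - p12' + t2 + ta - z1' - z12' - z13' - z2' - z23' - z3' + η) (hR13 : 0 ≤ -p12' + t2 + ta - z12' - z3' + η) (hR14 : 0 ≤ 1 - c2' - c3' - p23' - ta - th + z1 - z1' + z12 - z12' + z13 - z13' - z2' - z23' - z3' - η) (hR15 : 0 ≤ 1 - p23' - ta - th + z1 - z1' - z23' - η) (hR16 : 0 ≤ 1 - c3' - d3' - t2 - ta - th + z12 - z12' - z3' - η) (hR17 : 0 ≤ -c2' - d2' + t2 + z13 - z13' - z2') (hR18 : 0 ≤ 1 - c1' - c3' - p13' - t2 - z1' + z12 - z12' - z13' + z2 - z2' + z23 - z23' - z3') (hR19 : 0 ≤ 1 - p13' - t2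 - z13' + z2 - z2') (hR20 : 0 ≤ -c1' - d1' - z1' + z23 - z23' + η) (hR21 : 0 ≤ -c1' - c2' - p12' + t2 - z1' - z12' + z13 - z13' - z2' + z23 - z23' + z3 - z3' + η) (hR22 : 0 ≤ -p12' + t2 - z12' + z3 - z3' + η) (hR23 : 0 ≤ z1 - z1' + z12 - z12' + z13 - z13' - z2' - z23' - z3') (hR24 : 0 ≤ z1 - z1' - z23') (hR25 : 0 ≤ c1 - c1' - c3' + p13 - p13' - t2 + z1 - z1' + z12 - z12' + z13 - z13' - z2' - z23' - z3') (hR26 : 0 ≤ -1 + c1 - c1' + d1 - d1' + ta + th + z1 - z1' - z23' + η) (hR27 : 0 ≤ -1 + c1 - c1' - c2' + p12 - p12' + t2 + ta + th + z1 - z1' + z12 - z12' + z13 - z13' - z2' - z23' - z3' + η) (hR28 : 0 ≤ z12 - z12' - z3') (hR29 : 0 ≤ -1 + p12 - p12' + t2 + ta + th + z12 - z12' - z3' + η) (hR30 : 0 ≤ z13 - z13' - z2') (hR31 : 0 ≤ p13 - p13' - t2 + z13 - z13' - z2') (hR32 : 0 ≤ -z1' + z12 - z12' - z13' + z2 - z2'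 + z23 - z23' - z3') (hR33 : 0 ≤ -z13' + z2 - z2') (hR34 : 0 ≤ c2 - c2' - c3' + p23 - p23' - ta - z1' + z12 - z12' - z13' + z2 - z2' + z23 - z23' - z3' - η) (hR35 : 0 ≤ -1 + c2 - c2' + d2 - d2' + t2 - z13' + z2 - z2') (hR36 : 0 ≤ -1 - c1' + c2 - c2' + p12 - p12' + t2 + ta - z1' + z12 - z12' - z13' + z2 - z2' + z23 - z23' - z3' + η) (hR37 : 0 ≤ -z1' + z23 - z23') (hR38 : 0 ≤ p23 - p23' - z1' + z23 - z23' - η) (hR39 : 0 ≤ -z1' - z12' + z13 - z13' - z2' + z23 - z23' + z3 - z3') (hR40 : 0 ≤ -z12' + z3 - z3') (hR41 : 0 ≤ -c2' + c3 - c3' + p23 - p23' - z1' - z12' + z13 - z13' - z2' + z23 - z23' + z3 - z3' - η) (hR42 : 0 ≤ c3 - c3' + d3 - d3' - t2 - z12' + z3 - z3' - η) (hR43 : 0 ≤ -c1' + c3 - c3' + p13 - p13' - t2 - z1' - z12' + z13 - z13' - z2' + z23 - z23' + z3 - z3'), (prodBernoulli w).real ((openConn o a₁ ∪ openConn o a₂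 ∪ openConn o a₃) \ openConn o b) ≤ (prodBernoulli w).real ((openConn a₃ b)ᶜ) := by
  intro n w o b a₁ a₂ a₃ h12 h13 h23 hτ31 hτ32 η c1 c1' d1 d1' c2 c2' d2 d2' c3 c3' d3 d3' p12 p12' p13 p13' p23 p23' t2 th ta z1 z1' z23 z23' z2 z2' z13 z13' z3 z3' z12 z12' h0_η h0_c1 h0_d1 h0_c2 h0_d2 h0_c3 h0_d3 h0_p12 h0_p13 h0_p23 h0_t2 h0_th h0_ta hx_c1 hx_d1 hx_c2 hx_d2 hx_c3 hx_d3 hx_p12 hx_p13 hx_p23 hz_z1 hz_z23 hz_z2 hz_z13 hz_z3 hz_z12 hR1 hR2 hR3 hR4 hR5 hR6 hR7 hR8 hR9 hR10 hR11 hR12 hR13 hR14 hR15 hR16 hR17 hR18 hR19 hR20 hR21 hR22 hR23 hR24 hR25 hR26 hR27 hR28 hR29 hR30 hR31 hR32 hR33 hR34 hR35 hR36 hR37 hR38 hR39 hR40 hR41 hR42 hR43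
  have hnn : ∀ s : Set (BondConfig (Fin n)), 0 ≤ (prodBernoulli w).real s := fun _ => measureReal_nonneg
  have hmono : ∀ s t : Set (BondConfig (Fin n)), s ⊆ t → (prodBernoulli w).real s ≤ (prodBernoulli w).real t :=
    fun s t hst => measureReal_mono hst
  have Xany1 := stub_crossAnyOneTwo_c7 n w a₁ a₂ a₃ o b h12 h13
  have gXany1 : c1 * (prodBernoulli w).real (((openConn a₁ a₂)ᶜ ∩ (openConn a₁ a₃)ᶜ) ∩ (openConn a₁ o ∩ (openConn a₂ b ∪ openConn a₃ b))) ≤ c1' * (prodBernoulli w).real (((openConn a₁ a₂)ᶜ ∩ (openConn a₁ a₃)ᶜ) ∩ (openConn a₂ b ∪ openConn a₃ b)) :=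
    familyU_cross_gap (hnn _) (hnn _) (hmono _ _ (fun ω hω => hω.1)) (hnn _) (hmono _ _ (fun ω hω => hω.1)) Xany1 h0_c1 hx_c1
  have Xall1 := stub_crossAllOneTwo_c7 n w a₁ a₂ a₃ o b h12 h13
  have gXall1 : d1 * (prodBernoulli w).real (((openConn a₁ a₂)ᶜ ∩ (openConn a₁ a₃)ᶜ) ∩ (openConn a₁ o ∩ (openConn a₂ b ∩ openConn a₃ b))) ≤ d1' * (prodBernoulli w).real (((openConn a₁ a₂)ᶜ ∩ (openConn a₁ a₃)ᶜ) ∩ (openConn a₂ b ∩ openConn a₃ b)) :=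
    familyU_cross_gap (hnn _) (hnn _) (hmono _ _ (fun ω hω => hω.1)) (hnn _) (hmono _ _ (fun ω hω => hω.1)) Xall1 h0_d1 hx_d1
  have Xany2 := stub_crossAnyOneTwo_c7 n w a₂ a₁ a₃ o b h12.symm h23
  have gXany2 : c2 * (prodBernoulli w).real (((openConn a₂ a₁)ᶜ ∩ (openConn a₂ a₃)ᶜ) ∩ (openConn a₂ o ∩ (openConn a₁ b ∪ openConn a₃ b))) ≤ c2' * (prodBernoulli w).real (((openConn a₂ a₁)ᶜ ∩ (openConn a₂ a₃)ᶜ) ∩ (openConn a₁ b ∪ openConn a₃ b)) :=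
    familyU_cross_gap (hnn _) (hnn _) (hmono _ _ (fun ω hω => hω.1)) (hnn _) (hmono _ _ (fun ω hω => hω.1)) Xany2 h0_c2 hx_c2
  have Xall2 := stub_crossAllOneTwo_c7 n w a₂ a₁ a₃ o b h12.symm h23
  have gXall2 : d2 * (prodBernoulli w).real (((openConn a₂ a₁)ᶜ ∩ (openConn a₂ a₃)ᶜ) ∩ (openConn a₂ o ∩ (openConn a₁ b ∩ openConn a₃ b))) ≤ d2' * (prodBernoulli w).real (((openConn a₂ a₁)ᶜ ∩ (openConn a₂ a₃)ᶜ) ∩ (openConn a₁ b ∩ openConn a₃ b)) :=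
    familyU_cross_gap (hnn _) (hnn _) (hmono _ _ (fun ω hω => hω.1)) (hnn _) (hmono _ _ (fun ω hω => hω.1)) Xall2 h0_d2 hx_d2
  have Xany3 := stub_crossAnyOneTwo_c7 n w a₃ a₁ a₂ o b h13.symm h23.symm
  have gXany3 : c3 * (prodBernoulli w).real (((openConn a₃ a₁)ᶜ ∩ (openConn a₃ a₂)ᶜ) ∩ (openConn a₃ o ∩ (openConn a₁ b ∪ openConn a₂ b))) ≤ c3' * (prodBernoulli w).real (((openConn a₃ a₁)ᶜ ∩ (openConn a₃ a₂)ᶜ) ∩ (openConn a₁ b ∪ openConn a₂ b)) :=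
    familyU_cross_gap (hnn _) (hnn _) (hmono _ _ (fun ω hω => hω.1)) (hnn _) (hmono _ _ (fun ω hω => hω.1)) Xany3 h0_c3 hx_c3
  have Xall3 := stub_crossAllOneTwo_c7 n w a₃ a₁ a₂ o b h13.symm h23.symm
  have gXall3 : d3 * (prodBernoulli w).real (((openConn a₃ a₁)ᶜ ∩ (openConn a₃ a₂)ᶜ) ∩ (openConn a₃ o ∩ (openConn a₁ b ∩ openConn a₂ b))) ≤ d3' * (prodBernoulli w).real (((openConn a₃ a₁)ᶜ ∩ (openConn a₃ a₂)ᶜ) ∩ (openConn a₁ b ∩ openConn a₂ b)) :=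
    familyU_cross_gap (hnn _) (hnn _) (hmono _ _ (fun ω hω => hω.1)) (hnn _) (hmono _ _ (fun ω hω => hω.1)) Xall3 h0_d3 hx_d3
  have X12 := stub_crossAnyTwoOne_c7 n w a₁ a₂ a₃ o b h13 h23
  rw [knThm2_openConn_comm a₁ a₃, knThm2_openConn_comm a₂ a₃] at X12
  have gX12 : p12 * (prodBernoulli w).real (((openConn a₃ a₁)ᶜ ∩ (openConn a₃ a₂)ᶜ) ∩ ((openConn a₁ o ∪ openConn a₂ o) ∩ openConn a₃ b)) ≤ p12' * (prodBernoulli w).real (((openConn a₃ a₁)ᶜ ∩ (openConn a₃ a₂)ᶜ) ∩ openConn a₃ b) :=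
    familyU_cross_gap (hnn _) (hnn _) (hmono _ _ (fun ω hω => hω.1)) (hnn _) (hmono _ _ (fun ω hω => hω.1)) X12 h0_p12 hx_p12
  have X13 := stub_crossAnyTwoOne_c7 n w a₁ a₃ a₂ o b h12 h23.symm
  rw [knThm2_openConn_comm a₁ a₂, knThm2_openConn_comm a₃ a₂] at X13
  have gX13 : p13 * (prodBernoulli w).real (((openConn a₂ a₁)ᶜ ∩ (openConn a₂ a₃)ᶜ) ∩ ((openConn a₁ o ∪ openConn a₃ o) ∩ openConn a₂ b)) ≤ p13' * (prodBernoulli w).real (((openConn a₂ a₁)ᶜ ∩ (openConn a₂ a₃)ᶜ) ∩ openConn a₂ b) :=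
    familyU_cross_gap (hnn _) (hnn _) (hmono _ _ (fun ω hω => hω.1)) (hnn _) (hmono _ _ (fun ω hω => hω.1)) X13 h0_p13 hx_p13
  have X23 := stub_crossAnyTwoOne_c7 n w a₂ a₃ a₁ o b h12.symm h13.symm
  rw [knThm2_openConn_comm a₂ a₁, knThm2_openConn_comm a₃ a₁] at X23
  have gX23 : p23 * (prodBernoulli w).real (((openConn a₁ a₂)ᶜ ∩ (openConn a₁ a₃)ᶜ) ∩ ((openConn a₂ o ∪ openConn a₃ o) ∩ openConn a₁ b)) ≤ p23' * (prodBernoulli w).real (((openConn a₁ a₂)ᶜ ∩ (openConn a₁ a₃)ᶜ) ∩ openConn a₁ b) :=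
    familyU_cross_gap (hnn _) (hnn _) (hmono _ _ (fun ω hω => hω.1)) (hnn _) (hmono _ _ (fun ω hω => hω.1)) X23 h0_p23 hx_p23
  have T2 := stub_exchangePlain_c7 n w a₃ a₂ b hτ32
  have T1h := stub_exchangeHas_c7 n w a₃ a₁ o b hτ31
  have T1a := stub_exchangeAvoid_c7 n w a₃ a₁ o b hτ31
  have sT2 : 0 ≤ t2 * ((prodBernoulli w).real (openConn a₂ b ∩ (openConn a₃ a₂)ᶜ) - (prodBernoulli w).real (openConn a₃ b ∩ (openConn a₃ a₂)ᶜ)) := mul_nonneg h0_t2 (by linarith only [T2])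
  have sT1h : 0 ≤ th * ((prodBernoulli w).real ((openConn a₁ b ∩ (openConn a₃ a₁)ᶜ) ∩ openConn a₁ o) - (prodBernoulli w).real ((openConn a₃ b ∩ (openConn a₃ a₁)ᶜ) ∩ openConn a₁ o)) := mul_nonneg h0_th (by linarith only [T1h])
  have sT1a : 0 ≤ ta * ((prodBernoulli w).real ((openConn a₁ b ∩ (openConn a₃ a₁)ᶜ) ∩ (openConn a₃ o)ᶜ) - (prodBernoulli w).real ((openConn a₃ b ∩ (openConn a₃ a₁)ᶜ) ∩ (openConn a₃ o)ᶜ)) := mul_nonneg h0_ta (by linarith only [T1a])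
  have sEta : 0 ≤ η * ((prodBernoulli w).real (openConn a₁ b) - (prodBernoulli w).real (openConn a₃ b)) := mul_nonneg h0_η (by linarith only [hτ31])
  have hpt := fun ω => familyU_pointwise n o b a₁ a₂ a₃ η c1 c1' d1 d1' c2 c2' d2 d2' c3 c3' d3 d3' p12 p12' p13 p13' p23 p23' t2 th ta z1 z1' z23 z23' z2 z2' z13 z13' z3 z3' z12 z12'
    hR1 hR2 hR3 hR4 hR5 hR6 hR7 hR8 hR9 hR10 hR11 hR12 hR13 hR14 hR15 hR16 hR17 hR18 hR19 hR20 hR21 hR22 hR23 hR24 hR25 hR26 hR27 hR28 hR29 hR30 hR31 hR32 hR33 hR34 hR35 hR36 hR37 hR38 hR39 hR40 hR41 hR42 hR43 ω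
  have hint := stub_lincombIntegral_c7 n w _ hpt
  simp only [List.map_cons, List.map_nil, List.sum_cons, List.sum_nil, add_zero] at hint
  linarith only [hint, gXany1, gXall1, gXany2, gXall2, gXany3, gXall3, gX12, gX13, gX23, hz_z1, hz_z23, hz_z2, hz_z13, hz_z3, hz_z12, sT2, sT1h, sT1a, sEta]

end Summit.CriticalPhenomena.PercolationContinuityZ3.Theorems
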